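import Summits.CriticalPhenomena.CardyFormulaZ2.Theorems.CardyIKTransportIKLinearTransportStubCouplingToLimitsGeometry
import Summits.CriticalPhenomena.CardyFormulaZ2.Theorems.CardyIKTransportIKLinearTransportStubCouplingToLimitsTransfer
import Summits.CriticalPhenomena.CardyFormulaZ2.Theorems.CardyIKTransportIKLinearTransportStubCouplingToLimitsEvents
import Literature.Probability.RandomPlanarGeometry.CrossRatioContinuity
import Mathlib.Analysis.SpecificLimits.Basic

/-!
# Stub `stub_CouplingToLimits` (line `pinned-diagram-exchange`, crux `CardyIKTransport.IKLinearTransport`,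
# stmt-CriticalPhenomena-5076) — part 4: the transfer under the coupling and the assembly

`stub_CouplingToLimits : (∃ K₁, IsTransportCoupling K₁) → (∃ K₀, IsTriShear K₀ ∧ CrudeCardyAlong K₀ ∅) →
∃ K₁, TransportsWithin K₁` (registered stub of the lead's skeleton, proved here under its registered name).

Proof. By part 1 it suffices to show Cardy's formula for the isotropic member `S = univ` on
`K₀K₁`-images. Fix `R`, a square model `Φ` of `R` (`exists_isSquareModel`, Schoenflies), and the charts
`Ψ₁ = K₁ ∘ Φ` (model-2 plane) and `Ψ₀ = K₀ ∘ Ψ₁` (modulus plane). The comparison rectangles are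
Schramm–Smirnov's perturbations `Q⁻_s = Ψ₁([-1+s, 1-s] × [-1-s, 1+s])` (taller–narrower) and
`Q⁺_s = Ψ₁([-1-s, 1+s] × [-1+s, 1-s])` (wider–shorter). DETERMINISTIC TRANSFER (`crude_transfer`, from
part 2): off the bad event of the coupling, a crude crossing of `Q⁻_s` in the `S = ∅` model is shadowed
by a black path of the isotropic model which contains a crude crossing of `R`, and a crude crossing of `R`
in the isotropic model is shadowed by a black path of the `S = ∅` model containing a crude crossing of
`Q⁺_s` — for all `ε, δ` below a threshold depending on `s`. With the coupling inequality (part 3) this is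
the sandwich `P_∅(Q⁻_s) − ε ≤ P_univ(R) ≤ P_∅(Q⁺_s) + ε` eventually in `δ`. The `K₀`-images of
`Q^±_s` are `Ψ₀`-images of rectangles converging to the square, so their boundary loops converge
uniformly and their moduli converge to that of `Ψ₀([-1,1]²) = K₀K₁R` (Radó:
`ConformalRectangle.tendsto_crossRatio_of_tendsto_mark`, tree); `CrudeCardyAlong K₀ ∅` gives the limits
`F(η(K₀Q^±_s))`, continuity of Cardy's `F` on `(0,1)` and the sandwich lemma of part 1 conclude.
-/

noncomputable section

namespace Summit.CriticalPhenomena.CardyFormulaZ2.Theorems.IKLinearTransport.PinnedDiagramExchange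

open scoped BigOperators Topology Classical MeasureTheory ProbabilityTheory ENNReal
open Filter Set Function MeasureTheory Metric
open Literature.Probability.Percolation hiding cardyFunction
open Literature.Probability.LatticeModels
open Literature.Probability.RandomPlanarGeometry

namespace CouplingToLimits

/-! ## The deterministic transfer between the two models -/

/-- DETERMINISTIC TRANSFER OF CRUDE CROSSINGS ALONG SHADOWS. Let `Ψ` be a chart, `M` a real-linear
automorphism, `T = [a₀, a₁] × [b₀, b₁]` taller–narrower than `W = [x₀, x₁] × [y₀, y₁]` (both in
`[-2, 2]²`). For all `ε, δ` below a threshold and all windows `ρ` above a threshold: if the observable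
configuration `x` has a crude crossing of `Ψ(T)` at mesh `δ` and every black path of `x` of diameter
`≥ ε` in the window is shadowed within `ε` after `M` by a black path of `x'`, then `x'` has a crude
crossing of `(M ∘ Ψ)(W)` at mesh `δ`. [folklore] -/
theorem crude_transfer (M : ℂ ≃L[ℝ] ℂ) (Ψ : ℂ ≃ₜ ℂ) {x₀ a₀ a₁ x₁ b₀ y₀ y₁ b₁ : ℝ}
    (h₁ : x₀ < a₀) (h₂ : a₀ < a₁) (h₃ : a₁ < x₁) (h₄ : b₀ < y₀) (h₅ : y₀ < y₁) (h₆ : y₁ < b₁)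
    (hx₀ : -2 ≤ x₀) (hx₁ : x₁ ≤ 2) (hb₀ : -2 ≤ b₀) (hb₁ : b₁ ≤ 2) :
    ∃ ε₀ : ℝ, 0 < ε₀ ∧ ∃ ρ₀ : ℝ, ∀ ε δ ρ : ℝ, 0 < ε → ε ≤ ε₀ → 0 < δ → δ ≤ ε₀ → ρ₀ ≤ ρ →
      ∀ x x' : Obs,
        blackEdges x ∈ embDomainCrossing sqEmb (perturbQuad Ψ a₀ a₁ b₀ b₁ h₂ (h₄.trans (h₅.trans h₆))).carrier δ
          ((perturbQuad Ψ a₀ a₁ b₀ b₁ h₂ (h₄.trans (h₅.trans h₆))).arc 0)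
          ((perturbQuad Ψ a₀ a₁ b₀ b₁ h₂ (h₄.trans (h₅.trans h₆))).arc 2) →
        (∀ p ∈ monoPaths x true, (∀ v ∈ p, ‖pos δ v‖ ≤ ρ) → (∃ v ∈ p, ∃ w ∈ p, ε ≤ ‖pos δ v - pos δ w‖) →
          ∃ p' ∈ monoPaths x' true, p' ∈ shadows M δ ε p) →
        blackEdges x' ∈ embDomainCrossing sqEmb
          (perturbQuad (Ψ.trans M.toHomeomorph) x₀ x₁ y₀ y₁ (h₁.trans (h₂.trans h₃)) h₅).carrier δ
          ((perturbQuad (Ψ.trans M.toHomeomorph) x₀ x₁ y₀ y₁ (h₁.trans (h₂.trans h₃)) h₅).arc 0)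
          ((perturbQuad (Ψ.trans M.toHomeomorph) x₀ x₁ y₀ y₁ (h₁.trans (h₂.trans h₃)) h₅).arc 2) := by
  set QT := perturbQuad Ψ a₀ a₁ b₀ b₁ h₂ (h₄.trans (h₅.trans h₆)) with hQT
  set Ψ' : ℂ ≃ₜ ℂ := Ψ.trans M.toHomeomorph with hΨ'
  set QW := perturbQuad Ψ' x₀ x₁ y₀ y₁ (h₁.trans (h₂.trans h₃)) h₅ with hQW
  -- the transfer constant of part 2, through the chart `Ψ'` of the target plane
  obtain ⟨ε₂, hε₂, htr⟩ := exists_transfer_eps (α := Site 2) Ψ' h₁ h₃ h₄ h₅ h₆ hx₀ hx₁ hb₀ hb₁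
  -- separation of the arcs and size of the source rectangle
  obtain ⟨d₀, hd₀, hsep⟩ := exists_pos_le_dist_arc_zero_two QT
  obtain ⟨ρT, hρT⟩ := QT.isBounded.exists_norm_le
  -- Lipschitz constant of `M`
  set C : ℝ := ‖(M : ℂ →L[ℝ] ℂ)‖ with hCdef
  have hC0 : 0 ≤ C := norm_nonneg _
  have hMlip : ∀ a b : ℂ, dist (M a) (M b) ≤ C * dist a b := fun a b => by
    rw [dist_eq_norm, dist_eq_norm, ← map_sub]; exact (M : ℂ →L[ℝ] ℂ).le_opNorm _
  refine ⟨min (ε₂ / 2) (min (ε₂ / (4 * (C + 1))) (d₀ / 8)), by positivity, ρT, ?_⟩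
  intro ε δ ρ hε hεle hδ hδle hρ x x' hcross hgood
  have hεa : ε ≤ ε₂ / 2 := hεle.trans (min_le_left _ _)
  have hδa : δ ≤ ε₂ / (4 * (C + 1)) := hδle.trans ((min_le_right _ _).trans (min_le_left _ _))
  have hδb : δ ≤ d₀ / 8 := hδle.trans ((min_le_right _ _).trans (min_le_right _ _))
  have hεb : ε ≤ d₀ / 8 := hεle.trans ((min_le_right _ _).trans (min_le_right _ _))
  have hδε₂ : δ ≤ ε₂ / 2 := hδle.trans (min_le_left _ _)
  have hCδ : C * (2 * δ) ≤ ε₂ / 2 := by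
    have h1 : C * (2 * δ) ≤ (C + 1) * (2 * δ) := by nlinarith
    have h2 : (C + 1) * (2 * δ) ≤ (C + 1) * (2 * (ε₂ / (4 * (C + 1)))) := by nlinarith
    have h3 : (C + 1) * (2 * (ε₂ / (4 * (C + 1)))) = ε₂ / 2 := by field_simp; ring
    linarith
  -- unpack the crude crossing of the source rectangle
  obtain ⟨u, hu, v, hv, hconn⟩ := mem_embDomainCrossing_iff.1 hcross
  obtain ⟨pa, hpa, hupa⟩ := exists_mem_arc_dist_le QT 0 hu
  obtain ⟨pb, hpb, hvpb⟩ := exists_mem_arc_dist_le QT 2 hv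
  have hab : d₀ ≤ dist pa pb := hsep pa hpa pb hpb
  have huv : u ≠ v := by
    rintro rfl
    have := dist_triangle_left pa pb ((δ : ℂ) * sqEmb u)
    linarith
  obtain ⟨p, hph, hpl, hpc, hpblack, hpS⟩ := exists_chain_of_mem_openConnIn hconn huv
  have hpne : p ≠ [] := by rintro rfl; simp at hph
  have hmono : p ∈ monoPaths x true := ⟨hpne, hpc, fun w hw => by simpa using hpblack w hw⟩
  have hwin : ∀ w ∈ p, ‖pos δ w‖ ≤ ρ := fun w hw => (hρT _ (hpS w hw)).trans hρ
  have hdiam : ∃ a ∈ p, ∃ b ∈ p, ε ≤ ‖pos δ a - pos δ b‖ := by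
    refine ⟨u, List.mem_of_mem_head? hph, v, List.mem_of_getLast? hpl, ?_⟩
    rw [← dist_eq_norm]
    have h1 := dist_triangle pa (pos δ u) pb
    have h2 := dist_triangle (pos δ u) (pos δ v) pb
    have h3 : dist pa (pos δ u) ≤ 2 * δ := by rw [dist_comm]; exact hupa
    change dist ((δ : ℂ) * sqEmb v) pb ≤ 2 * δ at hvpb
    have h4 : dist (pos δ v) pb ≤ 2 * δ := hvpb
    linarith
  -- the shadow in the target configuration
  obtain ⟨p', ⟨hp'ne, hp'c, hp'black⟩, hfwd, hbwd, hhd, hlt⟩ := hgood p hmono hwin hdiam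
  -- hypotheses of the chart transfer for the chain `pos δ (p')`
  have hchain : List.IsChain (fun a b => dist (pos δ a) (pos δ b) ≤ 2 * δ) p' :=
    hp'c.imp fun a b h => dist_pos_le_of_adj h hδ.le
  have hpts : ∀ a ∈ p', ∃ z : ℂ, z.re ∈ Icc a₀ a₁ ∧ z.im ∈ Icc b₀ b₁ ∧ dist (pos δ a) (Ψ' z) ≤ ε₂ := by
    intro a ha
    obtain ⟨w, hw, hd⟩ := hbwd a ha
    have hwT : pos δ w ∈ QT.carrier := hpS w hw
    rw [hQT, perturbQuad, MarkedDomain.carrier_map] at hwT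
    obtain ⟨z, hz, hzw⟩ := hwT
    rw [mem_rectQuad_carrier] at hz
    refine ⟨z, Ioo_subset_Icc_self hz.1, Ioo_subset_Icc_self hz.2, ?_⟩
    have : Ψ' z = M (pos δ w) := by rw [← hzw]; rfl
    rw [this, dist_eq_norm]
    exact hd.trans (by linarith)
  have hends : ∀ (k : Fin 4) (q : ℂ) (c : Site 2) (a : Site 2), q ∈ QT.arc k → dist (pos δ c) q ≤ 2 * δ →
      ‖pos δ a - M (pos δ c)‖ ≤ ε → dist (pos δ a) (Ψ' (Ψ.symm q)) ≤ ε₂ := by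
    intro k q c a hq hcq hd
    have : Ψ' (Ψ.symm q) = M q := by simp [hΨ']
    rw [this]
    calc dist (pos δ a) (M q) ≤ dist (pos δ a) (M (pos δ c)) + dist (M (pos δ c)) (M q) := dist_triangle _ _ _
      _ ≤ ε + C * (2 * δ) := add_le_add (by rwa [dist_eq_norm]) ((hMlip _ _).trans
          (mul_le_mul_of_nonneg_left hcq hC0))
      _ ≤ ε₂ := by linarith
  have hhead : ∀ a, p'.head? = some a → ∃ z : ℂ, z.re ∈ Icc a₀ a₁ ∧ z.im = b₀ ∧ dist (pos δ a) (Ψ' z) ≤ ε₂ := by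
    intro a ha
    have hz := (mem_perturbQuad_arc_zero h₂ (h₄.trans (h₅.trans h₆)) Ψ).1 hpa
    exact ⟨Ψ.symm pa, hz.2, hz.1, hends 0 pa u a hpa hupa (hhd u a hph ha)⟩
  have hlast : ∀ a, p'.getLast? = some a → ∃ z : ℂ, z.re ∈ Icc a₀ a₁ ∧ z.im = b₁ ∧ dist (pos δ a) (Ψ' z) ≤ ε₂ := by
    intro a ha
    have hz := (mem_perturbQuad_arc_two h₂ (h₄.trans (h₅.trans h₆)) Ψ).1 hpb
    exact ⟨Ψ.symm pb, hz.2, hz.1, hends 2 pb v a hpb hvpb (hlt v a hpl ha)⟩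
  obtain ⟨m₁, m₂, m₃, hsplit, hm₂, hin, hmh, hml⟩ :=
    htr (pos δ) p' (2 * δ) (by positivity) (by linarith) hchain hpts hhead hlast hp'ne
  -- the middle piece is a black chain of `x'` inside the target quad, with ends near its arcs
  have hinf : m₂ <:+: p' := ⟨m₁, m₃, by rw [hsplit, List.append_assoc]⟩
  have hm₂c : List.IsChain (cellGraph x'.2).Adj m₂ := hp'c.infix hinf
  have hm₂b : ∀ w ∈ m₂, w ∈ x'.1 := fun w hw => by simpa using hp'black w (hinf.mem hw)
  have hm₂S : ∀ w ∈ m₂, w ∈ {y : Site 2 | (δ : ℂ) * sqEmb y ∈ QW.carrier} := by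
    intro w hw
    obtain ⟨z, hzre, hzim, hzw⟩ := hin w hw
    show pos δ w ∈ QW.carrier
    rw [hQW, perturbQuad, MarkedDomain.carrier_map, hzw]
    exact mem_image_of_mem _ ((mem_rectQuad_carrier _ _).2 ⟨hzre, hzim⟩)
  refine mem_embDomainCrossing_iff.2 ⟨m₂.head hm₂, ?_, m₂.getLast hm₂, ?_,
    mem_openConnIn_of_isChain m₂ hm₂ hm₂c hm₂b hm₂S⟩
  · obtain ⟨z, hzre, hzim, hd⟩ := hmh (m₂.head hm₂) (List.head?_eq_some_head hm₂)
    have hzarc : Ψ' z ∈ QW.arc 0 :=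
      (mem_perturbQuad_arc_zero _ _ Ψ').2 ⟨by simpa using hzim, by simpa using hzre⟩
    exact (Metric.infDist_le_dist_of_mem hzarc).trans hd
  · obtain ⟨z, hzre, hzim, hd⟩ := hml (m₂.getLast hm₂) (List.getLast?_eq_some_getLast hm₂)
    have hzarc : Ψ' z ∈ QW.arc 2 :=
      (mem_perturbQuad_arc_two _ _ Ψ').2 ⟨by simpa using hzim, by simpa using hzre⟩
    exact (Metric.infDist_le_dist_of_mem hzarc).trans hd

/-! ## Assembly -/

/-- Off the bad event, every long black path of either model in the window is shadowed in the other.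
[folklore] -/
theorem shadow_of_not_mem_badPair {K : ℂ ≃L[ℝ] ℂ} {δ ε ρ : ℝ} {ω₁ ω₂ : Ω}
    (h : (ω₁, ω₂) ∉ badPair K δ ε ρ) :
    (∀ p ∈ monoPaths (obs Set.univ ω₁) true, (∀ v ∈ p, ‖pos δ v‖ ≤ ρ) →
      (∃ v ∈ p, ∃ w ∈ p, ε ≤ ‖pos δ v - pos δ w‖) →
        ∃ p' ∈ monoPaths (obs ∅ ω₂) true, p' ∈ shadows K δ ε p) ∧
    (∀ p' ∈ monoPaths (obs ∅ ω₂) true, (∀ v ∈ p', ‖pos δ v‖ ≤ ρ) →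
      (∃ v ∈ p', ∃ w ∈ p', ε ≤ ‖pos δ v - pos δ w‖) →
        ∃ p ∈ monoPaths (obs Set.univ ω₁) true, p ∈ shadows K.symm δ ε p') := by
  constructor
  · intro p hp hw hd
    by_contra hc
    simp only [not_exists, not_and] at hc
    exact h ⟨true, Or.inl ⟨p, hp, hw, hd, fun p' hp' hs => hc p' hp' hs⟩⟩
  · intro p' hp' hw hd
    by_contra hc
    simp only [not_exists, not_and] at hc
    exact h ⟨true, Or.inr ⟨p', hp', hw, hd, fun p hp hs => hc p hp hs⟩⟩

/-- CARDY ON `K₀K`-IMAGES FOR THE ISOTROPIC MEMBER, from a transport coupling through `K` and crude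
Cardy along `K₀` for the `S = ∅` member. [folklore] -/
theorem hasCrossingLimit_univ_of_coupling (K K₀ : ℂ ≃L[ℝ] ℂ) (hK : IsTransportCoupling K)
    (hC : CrudeCardyAlong K₀ ∅) (R : ConformalRectangle) :
    ConformalRectangle.HasCrossingLimit ((R.map K.toHomeomorph).map K₀.toHomeomorph)
      (mixedCrossingProb Set.univ R) cardyFunction := by
  intro φ x hφx
  obtain ⟨Φ, hΦ⟩ := exists_isSquareModel R
  set Ψ₁ : ℂ ≃ₜ ℂ := Φ.trans K.toHomeomorph with hΨ₁
  set Ψ₀ : ℂ ≃ₜ ℂ := Ψ₁.trans K₀.toHomeomorph with hΨ₀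
  have hn1 : (-1 : ℝ) < 1 := by norm_num
  -- the modulus of `K₀ K R`, read on the square model
  obtain ⟨φ₀, x₀, hφ₀⟩ :=
    MarkedDomain.exists_isUniformizing_holds (perturbQuad Ψ₀ (-1) 1 (-1) 1 hn1 hn1)
  have hη : crossRatio x = crossRatio x₀ := by
    refine ConformalRectangle.crossRatio_eq_of_image_data
      (R := (R.map K.toHomeomorph).map K₀.toHomeomorph) (S := perturbQuad Ψ₀ (-1) 1 (-1) 1 hn1 hn1)
      (h := id) differentiableOn_id (injOn_id _) continuousOn_id ?_ ?_ hφx hφ₀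
    · rw [Set.image_id, MarkedDomain.carrier_map, MarkedDomain.carrier_map,
        ← isSquareModel_perturbQuad_carrier hΦ hn1 hn1, perturbQuad, perturbQuad,
        MarkedDomain.carrier_map, MarkedDomain.carrier_map, Set.image_image, Set.image_image]
      rfl
    · intro i
      rw [id, MarkedDomain.pt_map, MarkedDomain.pt_map, ← isSquareModel_perturbQuad_pt hΦ hn1 hn1 i,
        perturbQuad, perturbQuad, MarkedDomain.pt_map, MarkedDomain.pt_map]
      rfl
  rw [hη]
  have hη₀ : crossRatio x₀ ∈ Ioo (0 : ℝ) 1 := ConformalRectangle.crossRatio_mem_Ioo_of_isUniformizing hφ₀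
  refine tendsto_of_forall_sandwich fun θ hθ => ?_
  -- continuity of Cardy's function at the modulus
  obtain ⟨τ, hτ, hF⟩ : ∃ τ : ℝ, 0 < τ ∧ ∀ η : ℝ, |η - crossRatio x₀| < τ →
      |cardyFunction η - cardyFunction (crossRatio x₀)| < θ := by
    have hc : ContinuousAt cardyFunction (crossRatio x₀) :=
      continuousOn_cardyFunction_Ioo.continuousAt (Ioo_mem_nhds hη₀.1 hη₀.2)
    obtain ⟨τ, hτ, h⟩ := Metric.continuousAt_iff.1 hc θ hθ
    refine ⟨τ, hτ, fun η hη => ?_⟩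
    have := h (by rwa [Real.dist_eq])
    rwa [Real.dist_eq] at this
  -- the comparison families of model rectangles
  set s : ℕ → ℝ := fun n => 1 / ((n : ℝ) + 1) / 4 with hsdef
  have hs0 : ∀ n, 0 < s n := fun n => by positivity
  have hs4 : ∀ n, s n ≤ 1 / 4 := fun n => by
    have h1 : 1 / ((n : ℝ) + 1) ≤ 1 := by
      rw [div_le_one (by positivity)]; linarith [n.cast_nonneg (α := ℝ)]
    show 1 / ((n : ℝ) + 1) / 4 ≤ 1 / 4
    linarith
  have hs : Tendsto s atTop (𝓝 0) := by
    have := (tendsto_one_div_add_atTop_nhds_zero_nat (𝕜 := ℝ)).div_const (4 : ℝ)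
    rw [hsdef]
    simpa using this
  have hTx : ∀ n, -1 + s n < 1 - s n := fun n => by linarith [hs4 n]
  have hTy : ∀ n, -1 - s n < 1 + s n := fun n => by linarith [hs0 n]
  -- uniformizing data of the `K₀`-images and convergence of their moduli
  have hexm := fun n => MarkedDomain.exists_isUniformizing_holds
    (perturbQuad Ψ₀ (-1 + s n) (1 - s n) (-1 - s n) (1 + s n) (hTx n) (hTy n))
  have hexp := fun n => MarkedDomain.exists_isUniformizing_holds
    (perturbQuad Ψ₀ (-1 - s n) (1 + s n) (-1 + s n) (1 - s n) (hTy n) (hTx n))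
  choose ψm ym hψm using hexm
  choose ψp yp hψp using hexp
  have hl1 : Tendsto (fun n => -1 + s n) atTop (𝓝 (-1)) := by
    simpa using (tendsto_const_nhds (x := (-1 : ℝ))).add hs
  have hl2 : Tendsto (fun n => 1 - s n) atTop (𝓝 1) := by
    simpa using (tendsto_const_nhds (x := (1 : ℝ))).sub hs
  have hl3 : Tendsto (fun n => -1 - s n) atTop (𝓝 (-1)) := by
    simpa using (tendsto_const_nhds (x := (-1 : ℝ))).sub hs
  have hl4 : Tendsto (fun n => 1 + s n) atTop (𝓝 1) := by
    simpa using (tendsto_const_nhds (x := (1 : ℝ))).add hs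
  have hcm : Tendsto (fun n => crossRatio (ym n)) atTop (𝓝 (crossRatio x₀)) :=
    ConformalRectangle.tendsto_crossRatio_of_tendsto_mark
      (tendstoUniformly_boundary_perturbQuad Ψ₀ hTx hTy hn1 hn1 hl1 hl2 hl3 hl4)
      (fun i => tendsto_const_nhds) ψm ym hψm φ₀ x₀ hφ₀
  have hcp : Tendsto (fun n => crossRatio (yp n)) atTop (𝓝 (crossRatio x₀)) :=
    ConformalRectangle.tendsto_crossRatio_of_tendsto_mark
      (tendstoUniformly_boundary_perturbQuad Ψ₀ hTy hTx hn1 hn1 hl3 hl4 hl1 hl2)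
      (fun i => tendsto_const_nhds) ψp yp hψp φ₀ x₀ hφ₀
  obtain ⟨n, hnm, hnp⟩ : ∃ n, |crossRatio (ym n) - crossRatio x₀| < τ ∧
      |crossRatio (yp n) - crossRatio x₀| < τ := by
    obtain ⟨n, hn⟩ := (((Metric.tendsto_nhds.1 hcm) τ hτ).and ((Metric.tendsto_nhds.1 hcp) τ hτ)).exists
    exact ⟨n, by simpa only [Real.dist_eq] using hn.1, by simpa only [Real.dist_eq] using hn.2⟩
  -- the comparison rectangles in the plane of the `S = ∅` model and their Cardy limits
  set Qm := perturbQuad Ψ₁ (-1 + s n) (1 - s n) (-1 - s n) (1 + s n) (hTx n) (hTy n) with hQm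
  set Qp := perturbQuad Ψ₁ (-1 - s n) (1 + s n) (-1 + s n) (1 - s n) (hTy n) (hTx n) with hQp
  have hQmK : Qm.map K₀.toHomeomorph =
      perturbQuad Ψ₀ (-1 + s n) (1 - s n) (-1 - s n) (1 + s n) (hTx n) (hTy n) :=
    Negative.markedDomain_map_map _ _ _
  have hQpK : Qp.map K₀.toHomeomorph =
      perturbQuad Ψ₀ (-1 - s n) (1 + s n) (-1 + s n) (1 - s n) (hTy n) (hTx n) :=
    Negative.markedDomain_map_map _ _ _
  have hA : Tendsto (mixedCrossingProb ∅ Qm) (𝓝[>] 0) (𝓝 (cardyFunction (crossRatio (ym n)))) := by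
    have h := hC Qm
    rw [hQmK] at h
    exact h (ψm n) (ym n) (hψm n)
  have hB : Tendsto (mixedCrossingProb ∅ Qp) (𝓝[>] 0) (𝓝 (cardyFunction (crossRatio (yp n)))) := by
    have h := hC Qp
    rw [hQpK] at h
    exact h (ψp n) (yp n) (hψp n)
  refine ⟨mixedCrossingProb ∅ Qm, mixedCrossingProb ∅ Qp, _, _, hF _ hnm, hF _ hnp, hA, hB, ?_⟩
  -- thresholds of the two deterministic transfers
  have hsn : s n ≤ 1 / 4 := hs4 n
  have hsn0 : 0 < s n := hs0 n
  obtain ⟨ε₁, hε₁, ρ₁, htr₁⟩ := crude_transfer K.symm Ψ₁ (x₀ := -1) (a₀ := -1 + s n) (a₁ := 1 - s n)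
    (x₁ := 1) (b₀ := -1 - s n) (y₀ := -1) (y₁ := 1) (b₁ := 1 + s n) (by linarith) (hTx n) (by linarith)
    (by linarith) hn1 (by linarith) (by norm_num) (by norm_num) (by linarith) (by linarith)
  obtain ⟨ε₂, hε₂, ρ₂, htr₂⟩ := crude_transfer K Φ (x₀ := -1 - s n) (a₀ := -1) (a₁ := 1) (x₁ := 1 + s n)
    (b₀ := -1) (y₀ := -1 + s n) (y₁ := 1 - s n) (b₁ := 1) (by linarith) hn1 (by linarith) (by linarith)
    (hTx n) (by linarith) (by linarith) (by linarith) (by norm_num) (by norm_num)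
  set ε : ℝ := min θ (min ε₁ ε₂) with hεdef
  have hε : 0 < ε := lt_min hθ (lt_min hε₁ hε₂)
  set ρ : ℝ := max (max ρ₁ ρ₂) 1 with hρdef
  have hρ : 0 < ρ := lt_of_lt_of_le one_pos (le_max_right _ _)
  have hεθ : ε ≤ θ := min_le_left _ _
  have hεε₁ : ε ≤ ε₁ := (min_le_right _ _).trans (min_le_left _ _)
  have hεε₂ : ε ≤ ε₂ := (min_le_right _ _).trans (min_le_right _ _)
  have hρ₁ : ρ₁ ≤ ρ := (le_max_left _ _).trans (le_max_left _ _)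
  have hρ₂ : ρ₂ ≤ ρ := (le_max_right _ _).trans (le_max_left _ _)
  filter_upwards [hK ε ρ hε hρ, Ioo_mem_nhdsGT (lt_min hε₁ hε₂)] with δ hγ hδ
  obtain ⟨γ, h1, h2, hbad⟩ := hγ
  have hδε₁ : δ ≤ ε₁ := hδ.2.le.trans (min_le_left _ _)
  have hδε₂ : δ ≤ ε₂ := hδ.2.le.trans (min_le_right _ _)
  constructor
  · -- lower bound: a crude crossing of `Q⁻` in the `S = ∅` model forces one of `R` in the isotropic model
    have key : ∀ q : Ω × Ω,
        q.2 ∈ {ω : Ω | blackEdges (obs ∅ ω) ∈ embDomainCrossing sqEmb Qm.carrier δ (Qm.arc 0) (Qm.arc 2)} →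
        q ∉ badPair K δ ε ρ →
        q.1 ∈ {ω : Ω | blackEdges (obs Set.univ ω) ∈
          embDomainCrossing sqEmb R.carrier δ (R.arc 0) (R.arc 2)} := by
      rintro ⟨ω₁, ω₂⟩ hω₂ hnb
      have h := htr₁ ε δ ρ hε hεε₁ hδ.1 hδε₁ hρ₁ (obs ∅ ω₂) (obs Set.univ ω₁) hω₂
        (shadow_of_not_mem_badPair hnb).2
      rw [trans_trans_symm_toHomeomorph Φ K] at h
      rwa [isSquareModel_perturbQuad_carrier hΦ, isSquareModel_perturbQuad_arc hΦ,
        isSquareModel_perturbQuad_arc hΦ] at h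
    have := real_le_of_coupling_snd h1 h2 hε.le hbad (measurableSet_crudeEvent ∅ _ δ _ _) key
    change μIK.real _ - θ ≤ μIK.real _
    linarith
  · -- upper bound: a crude crossing of `R` in the isotropic model forces one of `Q⁺` in the `S = ∅` model
    have key : ∀ q : Ω × Ω,
        q.1 ∈ {ω : Ω | blackEdges (obs Set.univ ω) ∈
          embDomainCrossing sqEmb R.carrier δ (R.arc 0) (R.arc 2)} →
        q ∉ badPair K δ ε ρ →
        q.2 ∈ {ω : Ω | blackEdges (obs ∅ ω) ∈ embDomainCrossing sqEmb Qp.carrier δ (Qp.arc 0) (Qp.arc 2)} := by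
      rintro ⟨ω₁, ω₂⟩ hω₁ hnb
      have hω₁' : blackEdges (obs Set.univ ω₁) ∈ embDomainCrossing sqEmb
          (perturbQuad Φ (-1) 1 (-1) 1 hn1 hn1).carrier δ ((perturbQuad Φ (-1) 1 (-1) 1 hn1 hn1).arc 0)
          ((perturbQuad Φ (-1) 1 (-1) 1 hn1 hn1).arc 2) := by
        rwa [isSquareModel_perturbQuad_carrier hΦ, isSquareModel_perturbQuad_arc hΦ,
          isSquareModel_perturbQuad_arc hΦ]
      exact htr₂ ε δ ρ hε hεε₂ hδ.1 hδε₂ hρ₂ (obs Set.univ ω₁) (obs ∅ ω₂) hω₁'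
        (shadow_of_not_mem_badPair hnb).1
    have := real_le_of_coupling_fst h1 h2 hε.le hbad (measurableSet_crudeEvent Set.univ _ δ _ _) key
    change μIK.real _ ≤ μIK.real _ + θ
    linarith

end CouplingToLimits

/-- THE REGISTERED STUB `stub_CouplingToLimits` of line `pinned-diagram-exchange` (crux
`CardyIKTransport.IKLinearTransport`, stmt-CriticalPhenomena-5076): from a transport coupling through
`K₁` (Manolescu's Thm 5.4 output, `IsTransportCoupling K₁`) and crude Cardy along the shear `K₀` for the
`S = ∅` member (`CrudeCardyAlong K₀ ∅`), the within-family equivalence of crude crossing limits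
`TransportsWithin K₁` (with the same `K₁`). [folklore] -/
theorem stub_CouplingToLimits :
    (∃ K₁ : ℂ ≃L[ℝ] ℂ, IsTransportCoupling K₁) → (∃ K₀ : ℂ ≃L[ℝ] ℂ, IsTriShear K₀ ∧ CrudeCardyAlong K₀ ∅) →
      ∃ K₁ : ℂ ≃L[ℝ] ℂ, TransportsWithin K₁ :=
  CouplingToLimits.stub_CouplingToLimits_of fun K₁ K₀ hK₁ hK₀ =>
    CouplingToLimits.hasCrossingLimit_univ_of_coupling K₁ K₀ hK₁ hK₀

end Summit.CriticalPhenomena.CardyFormulaZ2.Theorems.IKLinearTransport.PinnedDiagramExchange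

end
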